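import Summits.BirchSwinnertonDyer.BirchSwinnertonDyer.Theorems.PrintX8VSInputHondaSystemSprungHondaIso
import Literature.NumberTheory.EllipticCurves.FormalGroupFrobeniusTypeAllPrimesProofs
import HarnessLib

/-!
# Sprung's Honda system AT `p = 2`, IV: Honda's integral isomorphism for a logarithm of type `p − aT + T²` at EVERY prime
# (the hypothesis `p ≠ 2` of `SprungHonda.exists_integral_hondaIso` removed)

Seat `bsd-2adic-tower-1` GEN 66, hand H2-C1 (pen GEN 40 SUMMON 20260831T155847Z): first brick of the `a₂ = ±2` rows of (C1)
`F1Sign2.HondaSystemAtTwoExists` (the rows `a₂ = 0` are `…SupersingularHondaSystemAtTwoZero`). For `a₂ ≠ 0` the plus Honda points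
must be built from SPRUNG's logarithm `ℓ(X) = ∑ₖ x_k((1+X)^{p^k} − 1)` (`x_0 = 1`, `p x_1 = a`, `p x_{k+2} = a x_{k+1} − x_k`), which is
of Honda type `p − aT + T²` (`SprungHonda.norm_coeff_hondaShift_sprungLog_le_one`, any `p`); Honda's theorem then needs `log_E` to be of
the SAME type — at `p = 2` this is the tree's all-primes `WeierstrassCurve.norm_coeff_hondaShift_formalLog_le_one'`
(`FormalGroupFrobeniusTypeAllPrimesProofs`), replacing the odd-`p` `…_le_one` used by `SprungHonda.exists_integral_hondaIso`.

WHAT (THEOREMS ONLY; no definition, no named fact, no instance, no `sorry`): `exists_integral_hondaIso'` — for `M/ℤ_p` with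
elliptic generic and special fibre (ANY prime `p`), `a := HasseManin.tr (M mod p)`, and `ℓ ∈ Xℚ_p⟦X⟧` with `‖[X¹]ℓ‖ = 1` of Honda
type `p − aT + T²`: there are `i, j ∈ Xℤ_p⟦X⟧` with `i ∘ j = X = j ∘ i` and `log_E ∘ (i ⊗ ℚ_p) = ℓ`. Same proof as the odd-`p`
theorem (Honda's Thm. 2 via `norm_coeff_le_one_of_subst_eq`), one input swapped.
HONEST FRAMING: pure formal-group theory; closes no item; BSD is not proved by any of this.

References: [Honda1970] T. Honda, J. Math. Soc. Japan 22 (1970), Thm. 2, Thm. 9; [Kobayashi2003] Thm. 8.3 ii), Thm. 8.4;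
[Sprung2012] F. Sprung, J. Number Theory 132 (2012), proof of Thm. 2.2 (p. 1487: «Honda's theorems hold for p = 2 as well»).
-/

set_option autoImplicit false
-- the Theorems namespace of this sub repeats the summit name by design (D-0017 nested layout)
set_option linter.dupNamespace false

noncomputable section

open scoped Classical Topology NNReal
open Filter PowerSeries

namespace Summit.BirchSwinnertonDyer.BirchSwinnertonDyer.Theorems.SSHondaTwo

open Literature.RingTheory.FormalGroups (liftInt map_liftInt hondaShift norm_coeff_le_one_of_subst_eq map_subst_apply)
open Summit.BirchSwinnertonDyer.Rank1Residual.Additive.HondaFss (hasSubst_formalExp')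
open Summit.BirchSwinnertonDyer.BirchSwinnertonDyer.Theorems.SprungHonda

variable {p : ℕ} [hp : Fact p.Prime] (M : WeierstrassCurve ℤ_[p])
  [hE : (M.map PadicInt.Coe.ringHom).IsElliptic] [hEt : (M.map PadicInt.toZMod).IsElliptic]

/-- **Honda's isomorphism, integrally, at EVERY prime**: for `ℓ ∈ Xℚ_p⟦X⟧` with `‖[X¹]ℓ‖ = 1` of Honda type `p − aT + T²`,
`a = a_p(M) := HasseManin.tr (M mod p)`, there are `i, j ∈ Xℤ_p⟦X⟧` with `i ∘ j = X = j ∘ i` and `log_E ∘ (i ⊗ ℚ_p) = ℓ`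
(`i = exp_E ∘ ℓ`, `j = exp_ℓ ∘ log_E`; `log_E` is of the same type at every prime by the tree's all-primes Honda congruences
`WeierstrassCurve.norm_coeff_hondaShift_formalLog_le_one'`, and two logarithms of one type give integral transition series).
The odd-`p` twin is `SprungHonda.exists_integral_hondaIso`. [cite: Honda1970, Thm. 2 (p. 223), Thm. 9 (pp. 240–241)]
[cite: Kobayashi2003, Thm. 8.3 ii) and Thm. 8.4] -/
theorem exists_integral_hondaIso' {ℓ : ℚ_[p]⟦X⟧} (hℓ0 : constantCoeff ℓ = 0) (hℓ1 : ‖coeff 1 ℓ‖ = 1)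
    (hℓ : ∀ n, ‖coeff n (hondaShift p
      (Literature.NumberTheory.EllipticCurves.HasseManin.tr (M.map PadicInt.toZMod) : ℚ_[p]) ℓ)‖ ≤ 1) :
    ∃ i j : ℤ_[p]⟦X⟧, constantCoeff i = 0 ∧ constantCoeff j = 0 ∧ i.subst j = X ∧ j.subst i = X ∧
      (M.map (PadicInt.Coe.ringHom (p := p))).formalLog.subst (i.map PadicInt.Coe.ringHom) = ℓ := by
  obtain ⟨hψ0, hlog, hc1⟩ := formalExp_subst_props M hℓ0
  set ψ : ℚ_[p]⟦X⟧ := PowerSeries.subst ℓ (M.map (PadicInt.Coe.ringHom (p := p))).formalExp with hψdef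
  have hu : IsUnit (coeff 1 ψ) := by
    rw [hc1, isUnit_iff_ne_zero, ← norm_pos_iff, hℓ1]; exact one_pos
  have hψs : HasSubst ψ := HasSubst.of_constantCoeff_zero' hψ0
  set ψ' : ℚ_[p]⟦X⟧ := PowerSeries.substInvOfIsUnit ψ hu with hψ'def
  have hψ'0 : constantCoeff ψ' = 0 := PowerSeries.constantCoeff_substInvOfIsUnit _ _
  have hψ's : HasSubst ψ' := PowerSeries.HasSubst.substInvOfIsUnit _ _
  have hright : ψ.subst ψ' = X := PowerSeries.subst_substInvOfIsUnit_right ψ hψ0 hu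
  have hleft : ψ'.subst ψ = X := PowerSeries.subst_substInvOfIsUnit_left ψ hψ0 hu
  -- `ℓ ∘ ψ' = log_E`
  have hlog' : ℓ.subst ψ' = (M.map (PadicInt.Coe.ringHom (p := p))).formalLog := by
    have h := congrArg (fun F : ℚ_[p]⟦X⟧ ↦ F.subst ψ') hlog
    rw [← h, PowerSeries.subst_comp_subst_apply hψs hψ's, hright, PowerSeries.X_subst]
  -- integrality (Honda, every prime)
  have hElog := M.norm_coeff_hondaShift_formalLog_le_one'
  have hlog1 : ‖coeff 1 (M.map (PadicInt.Coe.ringHom (p := p))).formalLog‖ = 1 := by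
    rw [(M.map PadicInt.Coe.ringHom).coeff_one_formalLog, norm_one]
  have hint : ∀ n, ‖coeff n ψ‖ ≤ 1 :=
    norm_coeff_le_one_of_subst_eq (p := p) (Padic.norm_int_le_one _) hElog hℓ hlog1 hψ0 hlog
  have hint' : ∀ n, ‖coeff n ψ'‖ ≤ 1 :=
    norm_coeff_le_one_of_subst_eq (p := p) (Padic.norm_int_le_one _) hℓ hElog hℓ1 hψ'0 hlog'
  refine ⟨liftInt ψ hint, liftInt ψ' hint', ?_, ?_, ?_, ?_, ?_⟩
  · have h0 := congrArg (coeff 0) (map_liftInt ψ hint)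
    rw [coeff_map, PowerSeries.coeff_zero_eq_constantCoeff, PowerSeries.coeff_zero_eq_constantCoeff, hψ0] at h0
    exact Subtype.ext h0
  · have h0 := congrArg (coeff 0) (map_liftInt ψ' hint')
    rw [coeff_map, PowerSeries.coeff_zero_eq_constantCoeff, PowerSeries.coeff_zero_eq_constantCoeff, hψ'0] at h0
    exact Subtype.ext h0
  · apply Summit.BirchSwinnertonDyer.Rank1Residual.Additive.HondaFss.map_injective
    have hj0 : constantCoeff (liftInt ψ' hint') = 0 := by
      have h0 := congrArg (coeff 0) (map_liftInt ψ' hint')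
      rw [coeff_map, PowerSeries.coeff_zero_eq_constantCoeff, PowerSeries.coeff_zero_eq_constantCoeff, hψ'0] at h0
      exact Subtype.ext h0
    rw [map_subst_apply (HasSubst.of_constantCoeff_zero' hj0), map_liftInt, map_liftInt, PowerSeries.map_X]
    exact hright
  · apply Summit.BirchSwinnertonDyer.Rank1Residual.Additive.HondaFss.map_injective
    have hi0 : constantCoeff (liftInt ψ hint) = 0 := by
      have h0 := congrArg (coeff 0) (map_liftInt ψ hint)
      rw [coeff_map, PowerSeries.coeff_zero_eq_constantCoeff, PowerSeries.coeff_zero_eq_constantCoeff, hψ0] at h0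
      exact Subtype.ext h0
    rw [map_subst_apply (HasSubst.of_constantCoeff_zero' hi0), map_liftInt, map_liftInt, PowerSeries.map_X]
    exact hleft
  · rw [map_liftInt]; exact hlog

end Summit.BirchSwinnertonDyer.BirchSwinnertonDyer.Theorems.SSHondaTwo

end
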